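import Literature.Claims.NS.ClayVariants
import Literature.MeasureTheory.Lusin.LusinRealLine
import HarnessLib

/-!
# Claim skeleton: Moschandreou (2021), «Global Regularity Solution of the 4th Clay Millennium Problem
# for the Periodic Navier Stokes Equations» (arXiv:2011.07419v4)

Cell `ns-claims` (D-0090 NS-CLAIMS SWEEP), claim C05, typist `ns-claims-typist-3`.
UNREFEREED/DISPUTED CLAIM under adjudication — NOTHING in this file asserts a step: every `Step_k`
is a `Prop` (the paper's k-th load-bearing assertion, typed concretely so that `¬ Step_k` or its
vacuity can be a kernel theorem, to be filed by a refuter summit-side as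
`Theorems/SoloRefuteMoschandreou2021.lean`); the only `theorem`s are unfolding lemmas. THE AUTHOR
WITHDREW THIS CLAIM: arXiv v5 (27 Dec 2021) abstract — «the Clay Institute Millennium problem on
the Navier Stokes equations was not proven for a general enough vorticity form and [the earlier
papers] do not prove this as previously thought».

Version of record (pinned by ns-claims-lit-3): T. E. Moschandreou, arXiv:2011.07419 **v4**
[math.AP] (25 Sep 2021) [Moschandreou2021]; TeX source `pub/ns-claims/sources/Moschandreou2021/
arXiv-2011.07419v4-TeX_PINNED/Latex_Template_6.tex` (480 lines) — LOCATORS ARE TeX LINE NUMBERS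
`l.NNN` and equation numbers (no PDF pagination on the hub); print form = BPI book chapter (RAMRCS
vol. 4, pp. 79–92, 2021). LOCATORS.md by ns-claims-lit-3.

## Claimed statement (as printed) — ASSEMBLED (no theorem environment states it)

Abstract, l.101: «A rigorous proof of no finite time blowup of the 3D Incompressible Navier Stokes
equations in R³/T³ is hereby shown as well as results on the velocity-pressure distribution.»
Introduction, l.110: «… it is the purpose of the present work to … provide a rigorous mathematical
proof that G cannot be a blowup itself with respect to t except at a finite number of points in
any given bounded subset of R³/T³ if and only if in the initial data the energy is infinite.»
Discussion, l.297: «Proceeding by contradiction it was shown by the application of a sequence of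
five theorems that a blowup form is impossible for finite and large initial data.» Typed (referee
lane 2, F1: the abstract's sentence over the Clay (B) data class): `ClaimedTheorem :=
ClayVariants.clayPeriodic.Regularity` (printed (B): «periodic boundary conditions specified in
[Fefferman]», l.129).

## Clay delta (reference `ClayVariants.lean`) — «WRONG PROBLEM» CANDIDATE

Nearest: (B); `clayB_of_claimed` is `id`. The delta is not in the claimed sentence but in WHAT THE
ARGUMENT TREATS: (Δ4) the horizontal velocity is FIXED to the explicit field (8), l.153–159,
`u_x = sin(4t*)x + (cos(4t*)+2)y`, `u_y = (cos(4t*)−2)x − sin(4t*)y` (linear in `x, y`: neither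
ℤ³-periodic nor bounded, «a specific form testing for vortices in 2D»), and only `u_z` is solved
for, inside the ansatz class (9)–(10), l.161–176 («G any function», `H = C₁ + C₂e^{z/√c₃} +
C₃e^{−z/√c₃}`, not periodic in `z`); (Δ3) the forcing is PRESCRIBED and nonzero, l.145 («the x,y
force is either 0⃗, (1/δ², 1/δ²) or (sin(ωt)/δ², sin(ωt)/δ²) … the z force is either 0, 1/δ⁴ or
sin(ωt)/δ⁴ … ω is very large»); (Δ5) «if and only if in the initial data the energy is infinite»,
l.110; and l.245 concedes «there is finite time blowup for finite and negative c₃» inside the same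
family. Nothing in ll.128–293 quantifies over arbitrary smooth divergence-free periodic data, so
the typed steps DO NOT COMPOSE to `ClaimedTheorem`: `Composes` below is a `Prop` recording the
shape of the missing implication (LOGIC gap), not a theorem.

## Steps (paper item · TeX line · typist's private flag)

* `Step_1`  §2.1.1 «Decomposition of NSEs», (4)–(6) l.128–144 with (8) l.153–159 (and Appendix 2
  l.372–420, cited to the author's earlier papers): «a solution for Eqs. (1)–(3) exists in the form
  u = (u_x,u_y,u_z) : R⁺ × R³/Z³ → R³ (4)» whose horizontal components are the field (8) — typed:
  for `δ < 0` and a printed forcing there is a classical forced NS solution on `[0,∞)` of the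
  ansatz form, ℤ³-periodic at every time — suspicious (a ℤ³-periodic field cannot have the
  component `u_x` of (8): `ansatzVelocity_apply_zero`).
* `Step_2`  l.190–193 with l.247 (inside S2, the «only possible blowup form» (13)): «For c₃ large
  and positive the integral in Eq. (13) is an increasing function wrt t … G is monotone increasing
  towards the blowup time», «the monotonicity of G and hence u_z is given to be true due to form of
  Eq. (13)» — typed over ℝ as printed: the integral `∫₀ᵗ (sin 4s − cos 4s) e^{2c₃(sin 4s − cos 4s)} ds`
  is increasing in `t ≥ 0` for all large `c₃` — known-false pattern (the integrand is `−e^{−2c₃} < 0`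
  at `s = 0`).
* `Step_3`  Theorem 1 [Debreu] l.248–252 as cited (order-preserving continuous utility for a
  complete order with closed sections on a connected separable space), used at l.253–260 with
  `X = R⁺`, `R = ≥` — plausible (known; the instance used is `T = id`) — PROVED in-file, `step_3_holds`:
  AS CITED (one-directional «xRy ⇒ T(x) ≥ T(y)», no injectivity / representation clause) the statement
  is witnessed by any constant `T`; Debreu's representation theorem proper is not what l.248–252 prints.
* `Step_4`  Theorem 2 [Brouwer, invariance of domain] l.261–265 with `n = 1`, `g = T` — true (known).
* `Step_5`  Theorem 3 [Rudin] l.267–272 (measurable ∘ continuous is measurable; «u_z monotone in t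
  … therefore Borel measurable») — true (`step5_holds`, Mathlib).
* `Step_6`  Theorem 4 [Lusin] l.273–279 with the `E_n`/`F_n` construction («h = g∘u_z|_F is
  continuous») — plausible (known theorem; the gluing sentence «Λ = Σ χ_{E_n} Λ_n is continuous and
  can be extended to all of R» is not typed) — PROVED in-file, `step_6_holds` (revision: the tree's Lusin
  theorem on the real line in Royden's form, `Literature.MeasureTheory.Lusin.Real.exists_continuous_isClosed_subset_eqOn`).
* `Step_7`  **Theorem 5 (the paper's own), l.281–289**: «Let F, Y and Z be topological spaces with
  F, h in Lusin's theorem, h = g∘u_z : F → Z is continuous and let g : Y → Z be a homeomorphism.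
  Then it follows that u_z : X → Y is continuous» — typed over ℝ at the grain the proof uses
  (TYPING-HYGIENE F15): a MONOTONE `u : ℝ → ℝ` whose compositions with a homeomorphism are
  continuous on closed sets of arbitrarily small complementary measure is continuous on ℝ —
  known-false pattern (a step function).
Ordered index (TYPING-HYGIENE 11): Step 1 = `Step_1` ((4)–(6),(8), l.128–159) · Step 2 = `Step_2`
((13), l.190–193, l.247) · Step 3 = `Step_3` (Thm 1, l.248–260) · Step 4 = `Step_4` (Thm 2,
l.261–265) · Step 5 = `Step_5` (Thm 3, l.267–272) · Step 6 = `Step_6` (Thm 4, l.273–279) · Step 7 =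
`Step_7` (Thm 5, l.281–289). Not typed as steps: (5) l.134–138 and (18)–(20) l.377–420 (the
integro-differential equation for `u_z` — no load-bearing inference is drawn from its form beyond
Step 1), (9)–(12), (14)–(15) and Fig. 1 (examples), §2.2 l.290–291 («differentiating G … infinitely
many times … each derivative is continuous» — the same inference as Step 7 applied to each
`t`-derivative; inherits Step 7), §2.3 l.292–293 (pressure via Poisson (7) — one sentence, inherits
the velocity's regularity), Appendix 1 (17) (complex `tanh` profile).

## COMPOSITION — NOT proved (`Composes` is a `Prop`, LOGIC gap)

* `Composes : Prop := Step_1 → … → Step_7 → ClaimedTheorem` — NOT A THEOREM: Steps 1–2 speak of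
  ONE explicit forced ansatz family with non-periodic horizontal flow, Steps 3–7 are
  measure-theoretic generalities about a monotone real function; no printed sentence carries them
  to arbitrary smooth periodic data (l.245 even grants finite-time blow-up inside the family for
  `c₃ < 0`). `-- LOGIC: missing implication «every Clay (B) datum evolves inside the ansatz (4),
  (8), (9)» — absent from the text and incompatible with (8) not being periodic.`
* `clayB_of_claimed : ClaimedTheorem → clayPeriodic.Regularity` — `id`.
* `step5_holds : Step_5` — PROVED (Mathlib).

WHAT THIS IS NOT: not a claim about NS regularity or blow-up; not a claim about any author beyond the
typed locator.
-/

open MeasureTheory Set Filter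
open scoped ContDiff ENNReal Topology

namespace Literature.Claims.NS.Moschandreou2021

open Literature.Analysis.FluidPDE

noncomputable section

/-! ## Vocabulary (definitions with bodies; nothing asserted) -/

/-- The horizontal field (8), l.153–159, in the reduced variables of (2) (`t* = δ²t`, `C_* δ² = 1`):
`u_x = sin(4t*)·x + (cos(4t*) + 2)·y`, `u_y = (cos(4t*) − 2)·x − sin(4t*)·y` («a specific form
testing for vortices in 2D», l.160), completed by a third component `u_z` («only u_z is solved
for», (4) l.131 and (9) l.161): the ANSATZ velocity of the paper. [cite: Moschandreou2021, eq. (8), l.153–159] -/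
def ansatzVelocity (δ : ℝ) (uz : ℝ → EuclideanSpace ℝ (Fin 3) → ℝ) (t : ℝ)
    (q : EuclideanSpace ℝ (Fin 3)) : EuclideanSpace ℝ (Fin 3) :=
  WithLp.toLp 2 ![Real.sin (4 * (δ ^ 2 * t)) * q 0 + (Real.cos (4 * (δ ^ 2 * t)) + 2) * q 1,
    (Real.cos (4 * (δ ^ 2 * t)) - 2) * q 0 - Real.sin (4 * (δ ^ 2 * t)) * q 1,
    uz t q]

/-- The `x`-component of the ansatz velocity (unfolding). [cite: Moschandreou2021, eq. (8), l.153–159] -/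
theorem ansatzVelocity_apply_zero (δ : ℝ) (uz : ℝ → EuclideanSpace ℝ (Fin 3) → ℝ) (t : ℝ)
    (q : EuclideanSpace ℝ (Fin 3)) :
    ansatzVelocity δ uz t q 0 =
      Real.sin (4 * (δ ^ 2 * t)) * q 0 + (Real.cos (4 * (δ ^ 2 * t)) + 2) * q 1 := by
  simp [ansatzVelocity]

/-- The `y`-component of the ansatz velocity (unfolding). [cite: Moschandreou2021, eq. (8), l.153–159] -/
theorem ansatzVelocity_apply_one (δ : ℝ) (uz : ℝ → EuclideanSpace ℝ (Fin 3) → ℝ) (t : ℝ)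
    (q : EuclideanSpace ℝ (Fin 3)) :
    ansatzVelocity δ uz t q 1 =
      (Real.cos (4 * (δ ^ 2 * t)) - 2) * q 0 - Real.sin (4 * (δ ^ 2 * t)) * q 1 := by
  simp [ansatzVelocity]

/-- The `z`-component of the ansatz velocity is the free unknown `u_z` (unfolding).
[cite: Moschandreou2021, eq. (4) l.131 and eq. (9) l.161] -/
theorem ansatzVelocity_apply_two (δ : ℝ) (uz : ℝ → EuclideanSpace ℝ (Fin 3) → ℝ) (t : ℝ)
    (q : EuclideanSpace ℝ (Fin 3)) : ansatzVelocity δ uz t q 2 = uz t q := by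
  simp [ansatzVelocity]

/-- The printed forcing family, l.145: «the x,y force is either 0⃗, F_T = (1/δ², 1/δ²) or
(sin(ωt)/δ², sin(ωt)/δ²) and the z force is either 0, F_z = 1/δ⁴ or F_z = sin(ωt)/δ⁴ … Here ω is
very large» (typed as the three space-constant alternatives, any `ω`).
[cite: Moschandreou2021, l.145] -/
def IsPrintedForcing (δ : ℝ) (f : ℝ → EuclideanSpace ℝ (Fin 3) → EuclideanSpace ℝ (Fin 3)) :
    Prop :=
  (∀ t q, f t q = 0) ∨
    (∀ t q, f t q = WithLp.toLp 2 ![1 / δ ^ 2, 1 / δ ^ 2, 1 / δ ^ 4]) ∨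
    (∃ freq : ℝ, ∀ t q, f t q = Real.sin (freq * t) • WithLp.toLp 2 ![1 / δ ^ 2, 1 / δ ^ 2, 1 / δ ^ 4])

/-- The «integral in Eq. (13)», l.190–193: `I_{c₃}(t) = ∫₀ᵗ (sin 4s − cos 4s) e^{2c₃(sin 4s − cos 4s)} ds`
(the time-dependent part of the denominator of the «only possible blowup form» `G = η(t)⁻¹`).
[cite: Moschandreou2021, eq. (13), l.190–193] -/
def blowupIntegral (c₃ t : ℝ) : ℝ :=
  ∫ s in (0 : ℝ)..t, (Real.sin (4 * s) - Real.cos (4 * s)) *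
    Real.exp (2 * c₃ * (Real.sin (4 * s) - Real.cos (4 * s)))

/-! ## The claimed statement -/

/-- **The claim, assembled from abstract l.101 + Introduction l.110 + Discussion l.297** («A rigorous
proof of no finite time blowup of the 3D Incompressible Navier Stokes equations in R³/T³ is hereby
shown»; setting l.129: «periodic boundary conditions specified in [Fefferman] defined on a cube …
with associated Lattice»): Clay (B) as printed, over the schema of `ClayVariants.lean`. No theorem
environment in the text states it (LOCATORS §2; referee lane 2 F1). [cite: Moschandreou2021, abstract l.101, l.110, l.297] -/
def ClaimedTheorem : Prop :=
  ClayVariants.clayPeriodic.Regularity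

/-- The claimed sentence IS the printed Clay (B) leaf. [cite: Moschandreou2021, abstract l.101] -/
theorem clayB_of_claimed (h : ClaimedTheorem) : ClayVariants.clayPeriodic.Regularity :=
  h

/-! ## The steps -/

/-- **Step 1 — §2.1.1 «Decomposition of NSEs», (4)–(6) l.128–144 with the field (8) l.153–159**:
«Considering periodic boundary conditions specified in [Fefferman] defined on a cube subset
Ω ⊂ R³ with associated Lattice … is the periodic BVP for the NSEs. In [Moschandreou] and
[Moschandreou2] a solution for Eqs. (1)–(3) exists in the form u = (u_x,u_y,u_z) : R⁺ × R³/Z³ → R³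
(4) where u_z … satisfies the following integral equation (5) … b⃗ = (1/δ)u_x i⃗ + (1/δ)u_y j⃗ (6)
… It can be determined that [(8)]», for «δ ∈ (−ε, 0)» (l.160) and the forcing of l.145. Typed: for
every `δ < 0` there are a printed forcing, a viscosity, a third component `u_z` and a pressure such
that the ansatz velocity is a classical forced Navier–Stokes solution on `ℝ³ × [0,∞)` which is
ℤ³-periodic at every time (the map (4) is on `R³/Z³`). The integro-differential equation (5) itself
is not typed (no inference uses its form). Typist's flag: suspicious (the `x`-component of (8) is
`sin(4t*)x + (cos 4t* + 2)y` with `cos 4t* + 2 ≥ 1`: no ℤ³-periodic field has it).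
[cite: Moschandreou2021, eqs. (4)–(6) l.128–144 and eq. (8) l.153–159] -/
def Step_1 : Prop :=
  ∀ δ : ℝ, δ < 0 →
    ∃ (f : ℝ → EuclideanSpace ℝ (Fin 3) → EuclideanSpace ℝ (Fin 3)) (ν : ℝ)
      (uz : ℝ → EuclideanSpace ℝ (Fin 3) → ℝ) (P : ℝ → EuclideanSpace ℝ (Fin 3) → ℝ),
      IsPrintedForcing δ f ∧ 0 < ν ∧
      IsClassicalNSSolutionOn (Ici 0) ν f (ansatzVelocity δ uz) P ∧
      ∀ t : ℝ, 0 ≤ t → IsLatticePeriodic (ansatzVelocity δ uz t)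

/-- **Step 2 — the monotonicity of the «only possible blowup form» (13), l.190–193 and l.247:**
«For c₃ large and positive the integral in Eq. (13) is an increasing function wrt t and … G is
monotone increasing towards the blowup time» (l.193); «In the following sequence of theorems the
monotonicity of G and hence u_z is given to be true due to form of Eq. (13)» (l.247) — the
hypothesis under which Theorems 1–5 are applied. Typed over ℝ as printed: for all sufficiently
large `c₃ > 0` the integral `t ↦ ∫₀ᵗ (sin 4s − cos 4s) e^{2c₃(sin 4s − cos 4s)} ds` is monotone
increasing on `[0,∞)`. Typist's flag: known-false pattern (the integrand equals `−e^{−2c₃} < 0` at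
`s = 0`, so the integral decreases on `[0, π/16]`). [cite: Moschandreou2021, eq. (13) l.190–193 and l.247] -/
def Step_2 : Prop :=
  ∃ c₀ : ℝ, ∀ c₃ : ℝ, c₀ ≤ c₃ → MonotoneOn (blowupIntegral c₃) (Ici 0)

/-- **Step 3 — Theorem 1 [Debreu], l.248–252, as cited** («If R is a complete order in a
connected, separable topological space X such that xR, Rx are both closed for all x in X, then
there exists a continuous real-valued function T such that xRy ⇒ T(x) ≥ T(y)»), used at l.253–260
with `X = R⁺` and the order `≥` of the time line (l.145: «the greater than or equal relation is a
complete order on … the positive time line»). Typed for total preorders on `ℝ` with closed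
sections. Typist's flag: plausible (Debreu 1954/1964; the instance used has `T = id`).
[cite: Moschandreou2021, Theorem 1, l.248–260] -/
def Step_3 : Prop :=
  ∀ R : ℝ → ℝ → Prop, (∀ x, R x x) → (∀ x y z, R x y → R y z → R x z) → (∀ x y, R x y ∨ R y x) →
    (∀ x, IsClosed {y | R x y}) → (∀ x, IsClosed {y | R y x}) →
    ∃ T : ℝ → ℝ, Continuous T ∧ ∀ x y, R x y → T y ≤ T x

/-- **Step 4 — Theorem 2 [Brouwer, invariance of domain], l.261–265, with `n = 1`** («let Y = R and
Z = R and let g be the injection T in the theorem of Debreu … by invariance of domain, g is a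
homeomorphism»): an injective continuous `g : ℝ → ℝ` has open range and is a homeomorphism onto
it. Typist's flag: true (known; `n = 1` is elementary via strict monotonicity).
[cite: Moschandreou2021, Theorem 2, l.261–265] -/
def Step_4 : Prop :=
  ∀ g : ℝ → ℝ, Continuous g → Function.Injective g →
    IsOpen (range g) ∧ ∃ e : ℝ ≃ₜ range g, ∀ x, (e x : ℝ) = g x

/-- **Step 5 — Theorem 3 [Rudin], l.267–272** («let g : Y → Z be continuous. If … f : X → Y is
measurable, and if h = g∘f, then h : X → Z is measurable»; «f = u_z … monotone on t ∈ R⁺ … is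
therefore itself Borel measurable … h is measurable»), over `ℝ`. Typist's flag: true (`step5_holds`).
[cite: Moschandreou2021, Theorem 3, l.267–272] -/
def Step_5 : Prop :=
  (∀ (f g : ℝ → ℝ), Measurable f → Continuous g → Measurable (g ∘ f)) ∧
    ∀ f : ℝ → ℝ, Monotone f → Measurable f

/-- **Step 6 — Theorem 4 [Lusin], l.273–279** («Let h be a real-valued measurable function on E.
Then for each ε > 0, there is a continuous function Λ on X = R and a closed set F contained in E
for which h = Λ on F and m(E∖F) < ε»; applied on the pieces `E_n = [0,∞) ∩ [|c₃ₙ|, |c₃ₙ₊₁|)` to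
get «h = g∘u_z|_F is continuous»). Typed: the cited theorem for Lebesgue measure on `ℝ`. Typist's
flag: plausible (known theorem; the gluing «Λ = Σ χ_{E_n}Λ_n is continuous» is not typed).
[cite: Moschandreou2021, Theorem 4, l.273–279] -/
def Step_6 : Prop :=
  ∀ h : ℝ → ℝ, Measurable h → ∀ E : Set ℝ, MeasurableSet E → ∀ ε : ℝ, 0 < ε →
    ∃ (Λ : ℝ → ℝ) (F : Set ℝ), Continuous Λ ∧ IsClosed F ∧ F ⊆ E ∧
      volume (E \ F) < ENNReal.ofReal ε ∧ ∀ x ∈ F, h x = Λ x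

/-- **Step 7 — THEOREM 5 (the paper's own), l.281–289, LOAD-BEARING** («The final theorem shows that
necessarily u_z is continuous», l.279): «Let F, Y and Z be topological spaces with F, h in Lusin's
theorem, h = g∘u_z : F → Z is continuous and let g : Y → Z be a homeomorphism. Then it follows
that u_z : X → Y is continuous.» (Proof, l.287: «… W = u_z⁻¹(g⁻¹(R)) is open in F … which
contradicts the assumption that u_z is not continuous».) Typed over `X = Y = Z = ℝ` at the grain the
proof uses, with everything the text has in hand granted: `u` MONOTONE (l.247, l.272), `g` a
homeomorphism of `ℝ`, and — stronger than one Lusin set — for EVERY `ε > 0` a closed set `F` with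
`m(ℝ∖F) ≤ ε` on which `g∘u` is continuous; conclusion: `u` is continuous on `ℝ`. Typist's flag:
known-false pattern (continuity on large closed sets does not propagate to the deleted small set:
a monotone step function). [cite: Moschandreou2021, Theorem 5, l.281–289] -/
def Step_7 : Prop :=
  ∀ u : ℝ → ℝ, Monotone u → ∀ g : ℝ ≃ₜ ℝ,
    (∀ ε : ℝ, 0 < ε → ∃ F : Set ℝ, IsClosed F ∧ volume Fᶜ ≤ ENNReal.ofReal ε ∧
      ContinuousOn (g ∘ u) F) →
    Continuous u

/-! ## Composition (NOT a theorem) and the one discharged step -/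

/-- **The shape of the missing implication (LOGIC gap — a `Prop`, not a theorem).** Steps 1–2
concern ONE explicit forced ansatz family whose horizontal flow (8) is not periodic; Steps 3–7 are
generalities about a monotone real function of `t`; the text contains no sentence carrying them
to arbitrary smooth divergence-free ℤ³-periodic data with `f ≡ 0` (and l.245 grants «finite time
blowup for finite and negative c₃» inside the family). The paper's logic therefore does NOT
compose to `ClaimedTheorem`; this `Prop` records what a composition would have to prove.
-- LOGIC: missing implication «every Clay (B) datum evolves inside the ansatz (4), (8), (9) with a
-- printed forcing», absent from ll.128–297 and incompatible with (8) (not ℤ³-periodic).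
[cite: Moschandreou2021, l.128–297] -/
def Composes : Prop :=
  Step_1 → Step_2 → Step_3 → Step_4 → Step_5 → Step_6 → Step_7 → ClaimedTheorem

/-- **Step 5 (Rudin's measurability lemma, and monotone ⇒ measurable) holds** — Mathlib.
[cite: Moschandreou2021, Theorem 3, l.267–272] -/
theorem step5_holds : Step_5 :=
  ⟨fun _ _ hf hg => hg.measurable.comp hf, fun _ hf => hf.measurable⟩

/-- Image of an open interval under a continuous strictly monotone real function (IVT). [folklore] -/
private theorem image_Ioo_of_strictMono {g : ℝ → ℝ} (hg : Continuous g) (hm : StrictMono g) {a b : ℝ}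
    (hab : a < b) : g '' Ioo a b = Ioo (g a) (g b) := by
  apply Subset.antisymm
  · rintro _ ⟨x, hx, rfl⟩
    exact ⟨hm hx.1, hm hx.2⟩
  · exact intermediate_value_Ioo hab.le hg.continuousOn

/-- Image of an open interval under a continuous strictly antitone real function (IVT). [folklore] -/
private theorem image_Ioo_of_strictAnti {g : ℝ → ℝ} (hg : Continuous g) (hm : StrictAnti g) {a b : ℝ}
    (hab : a < b) : g '' Ioo a b = Ioo (g b) (g a) := by
  apply Subset.antisymm
  · rintro _ ⟨x, hx, rfl⟩
    exact ⟨hm hx.2, hm hx.1⟩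
  · exact intermediate_value_Ioo' hab.le hg.continuousOn

/-- **Invariance of domain for `n = 1`, open-map form**: a continuous injective `g : ℝ → ℝ` is an
open map (it is strictly monotone or antitone, `Continuous.strictMono_of_inj`, and maps open
intervals onto open intervals by the intermediate value theorem). [folklore] -/
private theorem isOpenMap_of_continuous_injective {g : ℝ → ℝ} (hg : Continuous g)
    (hinj : Function.Injective g) : IsOpenMap g := by
  rw [isOpenMap_iff_nhds_le]
  intro x
  rw [Filter.le_map_iff]
  intro U hU
  obtain ⟨ε, hε, hball⟩ := Metric.mem_nhds_iff.mp hU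
  have hsub : Ioo (x - ε) (x + ε) ⊆ U := by
    intro y hy; apply hball; rw [Metric.mem_ball, Real.dist_eq, abs_lt]; constructor <;> linarith [hy.1, hy.2]
  have hlt : x - ε < x + ε := by linarith
  have hxI : x ∈ Ioo (x - ε) (x + ε) := ⟨by linarith, by linarith⟩
  rcases hg.strictMono_of_inj hinj with hm | hm
  · have himg := image_Ioo_of_strictMono hg hm hlt
    have hopen : IsOpen (g '' Ioo (x - ε) (x + ε)) := by rw [himg]; exact isOpen_Ioo
    exact Filter.mem_of_superset (hopen.mem_nhds (mem_image_of_mem g hxI)) (image_mono hsub)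
  · have himg := image_Ioo_of_strictAnti hg hm hlt
    have hopen : IsOpen (g '' Ioo (x - ε) (x + ε)) := by rw [himg]; exact isOpen_Ioo
    exact Filter.mem_of_superset (hopen.mem_nhds (mem_image_of_mem g hxI)) (image_mono hsub)

/-- **Step 4 HOLDS (kernel)** — Brouwer's invariance of domain at `n = 1` as the paper invokes it
(Theorem 2, l.261–265): a continuous injective `g : ℝ → ℝ` has open range and is a homeomorphism
onto it (open embedding ⇒ `IsOpenEmbedding.isOpen_range`, `IsEmbedding.toHomeomorph`). Net Literature
debt −1; no statement of this file is changed. [cite: Moschandreou2021, Theorem 2, l.261–265] -/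
theorem step_4_holds : Step_4 := by
  intro g hg hinj
  have hemb : Topology.IsOpenEmbedding g :=
    Topology.IsOpenEmbedding.of_continuous_injective_isOpenMap hg hinj
      (isOpenMap_of_continuous_injective hg hinj)
  exact ⟨hemb.isOpen_range, ⟨hemb.isEmbedding.toHomeomorph, fun _ => rfl⟩⟩


/-! ## Step 3 discharged: Theorem 1 [Debreu] in the form cited -/

/-- **Step 3 HOLDS (kernel) — and carries no content in the form cited.** The print (l.248–252)
quotes Debreu's theorem with the ONE-DIRECTIONAL conclusion «there exists a continuous real-valued
function T such that xRy ⇒ T(x) ≥ T(y)»; without the converse direction (a utility REPRESENTATION,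
`xRy ↔ T(x) ≥ T(y)`, Debreu 1954/1964) or any injectivity clause, every constant function `T` is a
witness, for every relation `R` whatsoever. The discharge below records exactly this: the typed step
is true by `T := 0`; the injectivity of `T` that the next step (invariance of domain, l.261–265,
`Step_4`) needs is supplied in print by the instance `T = id` (l.253–260), not by the cited theorem.
No statement of this file is modified. [cite: Moschandreou2021, Theorem 1, l.248–260] -/
theorem step_3_holds : Step_3 := fun _R _ _ _ _ _ =>
  ⟨fun _ => 0, continuous_const, fun _ _ _ => le_rfl⟩


/-! ## Step 6 discharged: Theorem 4 [Lusin] for Lebesgue measure on `ℝ` -/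

/-- **Step 6 HOLDS (kernel)** — Theorem 4 [Lusin] as cited (l.273–279), for Lebesgue measure on `ℝ`,
a measurable `h : ℝ → ℝ` and a measurable set `E` of ANY (possibly infinite) measure: a continuous `Λ`
on all of `ℝ` and a closed `F ⊆ E` with `m(E ∖ F) < ε` and `h = Λ` on `F`. This is the tree's Lusin
theorem on the real line in Royden's form (`Literature.MeasureTheory.Lusin.Real.exists_continuous_isClosed_subset_eqOn`:
finite-measure Lusin on unit cells, locally finite gluing, Tietze extension). An in-file discharge of a
step typed «plausible (known theorem)»; no statement of the file is modified.
[cite: Moschandreou2021, Theorem 4, l.273–279] [cite: RoydenFitzpatrick2010, §3.3 Lusin's Theorem p. 66; Problem 29 p. 67] -/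
theorem step_6_holds : Step_6 := fun _h hh _E hE _ε hε => by
  obtain ⟨g, F, hg, hF, hFE, hμ, hEq⟩ :=
    Literature.MeasureTheory.Lusin.Real.exists_continuous_isClosed_subset_eqOn hh hE
      (ENNReal.ofReal_pos.2 hε).ne'
  exact ⟨g, F, hg, hF, hFE, hμ, hEq⟩

end

end Literature.Claims.NS.Moschandreou2021
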